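import Mathlib

/-!
# Characters of the norm-one group are determined by their lift `χ ↦ χ(y / ȳ)` (T3.3 / T3.5)

Blind re-derivation cell `pub-hodge-repro`, Tier 3, seat `t3-p2` (prover-pub-hodge-repro-t3-p2-g11-0), sub-goal T3.3 of
`route/TIER3.md` (§7 «N2 IS FREE»: «N2 ‹χ₀χ₁ = χ₂χ₃ on U(1)› is the exact equality `μ_{i₁,s} μ_{i₂,s} = μ_{i₃,cs} μ_{i₄,cs}`
(χ ↦ χ_K injective by Hilbert 90)», `proofs/t3-p2/R3R4-INSTANTIATION.md` §4.4bis: the map `χ ↦ χ_K`,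
`χ_K(x) := χ(x / x̄)`, from characters of `U(1)` to characters of the multiplicative group is injective because every
norm-one element is of the form `x / x̄`).  Target tree path `lean/Summits/Ventures/HodgeRepro/Tier3NormOneInjective.lean`;
`import Mathlib` only; theorems only (no definitions — the norm-one group enters as any subgroup `H` of `Lˣ` with
`x ∈ H ↔ N_{L/K}(x) = 1`, so that the file stays in the kernel-reviewed lane).

The elementary core, on the kernel, for ONE field extension `L/K` (a finite cyclic Galois extension with generator `g`;
`K L : Type`, the universe of Mathlib's `exists_div_of_norm_eq_one`; for a CM field `E` over its maximal real subfield
`E⁺` the generator is the complex conjugation):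

* `norm_smul`, `div_smul_mem` — the norm is `Gal`-invariant, so `y / g y ∈ H` for every unit `y` (`H` the norm-one
  subgroup, the «`U(1)`» of `L/K`);
* `exists_div_smul_eq` — **Hilbert 90** (Mathlib's `groupCohomology.exists_div_of_norm_eq_one`): every element of `H`
  is `y / g y` when `g` generates `Gal(L/K)`;
* `lift_injective` — hence `χ ↦ (y ↦ χ(y / g y))` (the cell's `χ ↦ χ_K`) is INJECTIVE on homomorphisms `H →* M`
  (any monoid `M`, e.g. `ℂˣ`); `eq_of_forall_div_smul_eq` (pointwise), `eq_one_of_forall_div_smul_eq_one`;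
* the CM case: `algebraMap_norm_eq_mul_complexConj` — for a CM number field `E` (Mathlib's `NumberField.IsCMField`) with
  complex conjugation `c = NumberField.IsCMField.complexConj E`, `N_{E/E⁺}(x) = x · c x`; `mem_zpowers_complexConj` —
  `c` generates `Gal(E/E⁺)`; `lift_complexConj_injective` / `eq_of_forall_div_complexConj_eq` — `χ ↦ (y ↦ χ(y / c y))`
  is injective on characters of `U(1)(E) = {x ∈ Eˣ : x · c x = 1}`.

What is NOT here: the adelic statement (`U(1)(𝔸)` = the restricted product over the places of `F′`), which adds Hilbert 90
at every completion (the same theorem) and the unit statement at the unramified places; the paper keeps that assembly.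

Nothing here says anything about the status of the Hodge conjecture for CM abelian varieties, which is NOT proved.
-/

set_option autoImplicit false

namespace HodgeRepro

namespace T3.NormOneInjective

section General

variable {K L : Type} [Field K] [Field L] [Algebra K L]

variable (g : L ≃ₐ[K] L)

/-- The norm is invariant under the Galois action: `N_{L/K}(g y) = N_{L/K}(y)`. -/
theorem norm_smul (y : Lˣ) : Algebra.norm K ((g • y : Lˣ) : L) = Algebra.norm K (y : L) := by
  simp [AlgEquiv.smul_units_def, Algebra.norm_eq_of_algEquiv]

variable [FiniteDimensional K L]

variable (H : Subgroup Lˣ) (hH : ∀ x : Lˣ, x ∈ H ↔ Algebra.norm K (x : L) = 1)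

include hH in
/-- `y / g y` has norm one: it lies in the norm-one subgroup `H`. -/
theorem div_smul_mem (y : Lˣ) : y / g • y ∈ H := by
  rw [hH, div_eq_mul_inv, Units.val_mul, Units.val_inv_eq_inv_val, map_mul, Algebra.norm_inv, norm_smul]
  exact mul_inv_cancel₀ (Algebra.norm_ne_zero_iff.mpr y.ne_zero)

section Hilbert90

variable [IsGalois K L] [IsCyclic (L ≃ₐ[K] L)]

include hH in
/-- **Hilbert 90** (Mathlib's `groupCohomology.exists_div_of_norm_eq_one`): if `g` generates `Gal(L/K)`, every element
of the norm-one subgroup `H` is `y / g y` for some unit `y`. -/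
theorem exists_div_smul_eq (hg : ∀ x, x ∈ Subgroup.zpowers g) (x : H) :
    ∃ y : Lˣ, y / g • y = (x : Lˣ) := by
  have hx : Algebra.norm K ((x : Lˣ) : L) = 1 := (hH _).mp x.2
  obtain ⟨y, hy⟩ := groupCohomology.exists_div_of_norm_eq_one hg hx
  refine ⟨y, Units.ext ?_⟩
  simpa [AlgEquiv.smul_units_def] using hy

/-- **The lift is injective**: the map `χ ↦ (y ↦ χ(y / g y))` from homomorphisms `H →* M` on the norm-one subgroup to
functions on `Lˣ` is injective (Hilbert 90). This is the sentence «`χ ↦ χ_K` is injective by Hilbert 90» of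
`route/TIER3.md` §7 N2, for one field extension. -/
theorem lift_injective {M : Type*} [Monoid M] (hg : ∀ x, x ∈ Subgroup.zpowers g) :
    Function.Injective (fun χ : H →* M => fun y : Lˣ => χ ⟨y / g • y, div_smul_mem g H hH y⟩) := by
  intro χ₁ χ₂ h
  ext x
  obtain ⟨y, hy⟩ := exists_div_smul_eq g H hH hg x
  have hx : (⟨y / g • y, div_smul_mem g H hH y⟩ : H) = x := Subtype.ext hy
  rw [← hx]
  exact congrFun h y

/-- Pointwise form: two characters of the norm-one subgroup agreeing on every `y / g y` are equal. -/
theorem eq_of_forall_div_smul_eq {M : Type*} [Monoid M] (hg : ∀ x, x ∈ Subgroup.zpowers g) {χ₁ χ₂ : H →* M}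
    (h : ∀ y : Lˣ, χ₁ ⟨y / g • y, div_smul_mem g H hH y⟩ = χ₂ ⟨y / g • y, div_smul_mem g H hH y⟩) :
    χ₁ = χ₂ :=
  lift_injective g H hH hg (funext h)

/-- A character of the norm-one subgroup which is trivial on every `y / g y` is trivial. -/
theorem eq_one_of_forall_div_smul_eq_one {M : Type*} [Monoid M] (hg : ∀ x, x ∈ Subgroup.zpowers g) {χ : H →* M}
    (h : ∀ y : Lˣ, χ ⟨y / g • y, div_smul_mem g H hH y⟩ = 1) : χ = 1 :=
  eq_of_forall_div_smul_eq g H hH hg (χ₂ := 1) (fun y => by rw [h y]; rfl)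

end Hilbert90

end General

section CM

open NumberField

open scoped Classical

variable (E : Type) [Field E] [NumberField E] [IsCMField E]

/-- Every element of `Gal(E/E⁺)` is a power of the complex conjugation (Mathlib's `zpowers_complexConj_eq_top`). -/
theorem mem_zpowers_complexConj (x : E ≃ₐ[maximalRealSubfield E] E) :
    x ∈ Subgroup.zpowers (IsCMField.complexConj E) := by
  rw [IsCMField.zpowers_complexConj_eq_top]
  exact Subgroup.mem_top x

/-- The Galois group of `E/E⁺` is `{1, c}`. -/
theorem univ_eq_pair_complexConj :
    (Finset.univ : Finset (E ≃ₐ[maximalRealSubfield E] E)) = {1, IsCMField.complexConj E} := by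
  symm
  apply Finset.eq_univ_of_card
  rw [Finset.card_pair (IsCMField.complexConj_ne_one E).symm, ← Nat.card_eq_fintype_card,
    IsGalois.card_aut_eq_finrank, Algebra.IsQuadraticExtension.finrank_eq_two]

/-- The norm of the CM extension `E/E⁺` is `x ↦ x · c x` (`c` the complex conjugation), as an element of `E`. -/
theorem algebraMap_norm_eq_mul_complexConj (x : E) :
    algebraMap (maximalRealSubfield E) E (Algebra.norm (maximalRealSubfield E) x) =
      x * IsCMField.complexConj E x := by
  rw [Algebra.norm_eq_prod_automorphisms, univ_eq_pair_complexConj,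
    Finset.prod_pair (IsCMField.complexConj_ne_one E).symm, AlgEquiv.one_apply]

/-- `N_{E/E⁺}(x) = 1 ↔ x · c x = 1`: the norm-one subgroup of `E/E⁺` is the cell's `U(1)(E)`. -/
theorem norm_eq_one_iff_mul_complexConj (x : E) :
    Algebra.norm (maximalRealSubfield E) x = 1 ↔ x * IsCMField.complexConj E x = 1 := by
  rw [← algebraMap_norm_eq_mul_complexConj, ← map_one (algebraMap (maximalRealSubfield E) E)]
  exact (algebraMap (maximalRealSubfield E) E).injective.eq_iff.symm

variable (H : Subgroup Eˣ) (hH : ∀ x : Eˣ, x ∈ H ↔ (x : E) * IsCMField.complexConj E x = 1)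

include hH in
/-- `U(1)(E)` as the norm-one subgroup of `E/E⁺`. -/
theorem mem_iff_norm_eq_one (x : Eˣ) : x ∈ H ↔ Algebra.norm (maximalRealSubfield E) (x : E) = 1 := by
  rw [hH, norm_eq_one_iff_mul_complexConj]

include hH in
/-- `y / ȳ ∈ U(1)(E)`. -/
theorem div_complexConj_mem (y : Eˣ) : y / IsCMField.complexConj E • y ∈ H :=
  div_smul_mem _ H (mem_iff_norm_eq_one E H hH) y

include hH in
/-- **The CM case.** For a CM number field `E` with complex conjugation `c` and `U(1)(E) = {x ∈ Eˣ : x · c x = 1}`, the map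
`χ ↦ (y ↦ χ(y / c y))` is injective on characters of `U(1)(E)`: Hilbert 90 for the quadratic extension `E/E⁺`. -/
theorem lift_complexConj_injective {M : Type*} [Monoid M] :
    Function.Injective
      (fun χ : H →* M => fun y : Eˣ => χ ⟨y / IsCMField.complexConj E • y, div_complexConj_mem E H hH y⟩) :=
  lift_injective _ H (mem_iff_norm_eq_one E H hH) (mem_zpowers_complexConj E)

include hH in
/-- The pointwise CM form: characters of `U(1)(E)` agreeing on every `y / ȳ` are equal. -/
theorem eq_of_forall_div_complexConj_eq {M : Type*} [Monoid M] {χ₁ χ₂ : H →* M}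
    (h : ∀ y : Eˣ,
      χ₁ ⟨y / IsCMField.complexConj E • y, div_complexConj_mem E H hH y⟩ =
        χ₂ ⟨y / IsCMField.complexConj E • y, div_complexConj_mem E H hH y⟩) :
    χ₁ = χ₂ :=
  lift_complexConj_injective E H hH (funext h)

end CM

end T3.NormOneInjective

end HodgeRepro
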